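import Literature.NumberTheory.Automorphic.DeuringTypeNumberFormula
import Mathlib.LinearAlgebra.Eigenspace.Basic
import Mathlib.LinearAlgebra.Matrix.Permutation
import Mathlib.LinearAlgebra.FiniteDimensional.Lemmas
import HarnessLib

/-!
# The involution `[I] ↦ [I P]` on `Cls O` for the maximal orders of `B_{p,∞}`: `T(p)` is its permutation matrix, and the
# `±1`-eigenspaces of `T(p)` on the Brandt module have dimensions `# Typ O` and `# Cls O - # Typ O`

For a Brandt setup `S : XiSetup 1 p` (a maximal order `O` of the definite quaternion algebra of prime discriminant `p`) let
`P` be the two-sided prime of `O` above `p` and `W : Cls O → Cls O`, `[I] ↦ [I P]` (an involution, `P² = pO`;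
`DefiniteMaximalOrdersLeftOrderFibres.lean`). The Brandt matrix at the ramified prime, `T(p) = Brandt.matrix O p`, is the
permutation matrix of `W` (Vignéras III §5 exercice 5.8: «P(p) est une matrice de permutation … d'ordre 2»):

* §1 `XiSetup.involutive_mk_rep_mul_normPrimeIdeal` (`W² = 1`), `XiSetup.matrix_ramified_symm` / `_transpose` (`T(p)` is
  symmetric), **`XiSetup.map_matrix_ramified_eq_permMatrix` / `matrix_ramified_eq_permMatrix`** (`T(p)` = Mathlib's
  `Equiv.Perm.permMatrix` of `W`), `XiSetup.det_matrix_ramified` (`det T(p) = sign W`), **`XiSetup.map_matrix_ramified_mulVec`**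
  (`(T(p) v)(c) = v(W c)` over any commutative ring; the tree already has `T(p)² = 1`, `Brandt.XiSetup.matrix_mul_self_of_dvd`).
* §2 on the Brandt module `ℚ^{Cls O}` (`Matrix.toLin'` of `T(p)`): `E₊ = {v : v ∘ W = v}` (`XiSetup.mem_eigenspace_one_iff`)
  = the functions of the type, `v = g ∘ typeOf` (`XiSetup.mem_eigenspace_one_iff_exists_comp_typeOf`, since the fibres of
  `Cls O → Typ O` are the `W`-orbits), `E₋ = {v : v ∘ W = -v}`; **`XiSetup.finrank_eigenspace_one : dim E₊ = # Typ O`** and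
  **`XiSetup.finrank_eigenspace_neg_one : dim E₋ = # Cls O - # Typ O`** (`E₊ ⊕ E₋ = ℚ^{Cls O}`,
  `XiSetup.isCompl_eigenspace_one_eigenspace_neg_one`; no other eigenvalue, `XiSetup.eigenspace_eq_bot_of_ne`,
  `XiSetup.hasEigenvalue_imp`); `+1` is always an eigenvalue and **`-1` is an eigenvalue iff `# Typ O < # Cls O`**
  (`XiSetup.hasEigenvalue_neg_one_iff`); `tr T(p) = 2t - h = dim E₊ - dim E₋` (`XiSetup.trace_matrix_ramified_eq`); with
  Deuring's formula (`DeuringTypeNumberFormula.lean`), `dim E_± = ½ h ± ¼([h(-p)] + h(-4p))` for `p ≥ 5`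
  (`XiSetup.finrank_eigenspaces_eq_deuring`).
* §3 `p = 11`: no eigenvalue `-1` (`W = id`, `t = h = 2`); `p = 37`: `dim E₊ = 2`, `dim E₋ = 1`.

## References

* [VignerasLNM800] M.-F. Vignéras, *Arithmétique des algèbres de quaternions*, LNM 800, Ch. III §5 exercice 5.8 (b)–(c)
  (Brandt matrices at the ramified primes are permutation matrices of order `2`).
* [Voight2021] J. Voight, *Quaternion Algebras*, GTM 288, Prop. 18.5.10, Cor. 18.5.12, Prop. 30.9.2 and (30.9.3).
-/

noncomputable section

open scoped Pointwise Matrix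

namespace Literature.NumberTheory.Automorphic

open HeckeTraceFormulaGL2Level
open Literature.NumberTheory.QuadraticFields.Quadratic

namespace Brandt

variable {p : ℕ} [hp : Fact p.Prime] (S : XiSetup 1 p)

/-! ## §1 The involution `W : [I] ↦ [I P]` and its permutation matrix `T(p)` -/

section Involution

/-- **`W : [I] ↦ [I P]` is an involution of `Cls O`.** [cite: VignerasLNM800, Ch. III §5 exercice 5.8 (c)] -/
theorem XiSetup.involutive_mk_rep_mul_normPrimeIdeal :
    Function.Involutive fun c : ClassSet S.O =>
      (Quotient.mk (rightClassSetoid S.O) ⟨c.rep * normPrimeIdeal S.O p, S.rep_mul_normPrimeIdeal_mem c⟩ : ClassSet S.O) :=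
  fun c => S.mk_rep_mul_normPrimeIdeal_mul_normPrimeIdeal c

/-- `W` is a bijection of `Cls O`. [cite: VignerasLNM800, Ch. III §5 exercice 5.8 (c)] -/
theorem XiSetup.bijective_mk_rep_mul_normPrimeIdeal :
    Function.Bijective fun c : ClassSet S.O =>
      (Quotient.mk (rightClassSetoid S.O) ⟨c.rep * normPrimeIdeal S.O p, S.rep_mul_normPrimeIdeal_mem c⟩ : ClassSet S.O) :=
  S.involutive_mk_rep_mul_normPrimeIdeal.bijective

/-- `[I_c P] = c' ⟺ [I_{c'} P] = c`. [cite: VignerasLNM800, Ch. III §5 exercice 5.8 (c)] -/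
theorem XiSetup.mk_rep_mul_normPrimeIdeal_eq_iff (c c' : ClassSet S.O) :
    (Quotient.mk (rightClassSetoid S.O) ⟨c.rep * normPrimeIdeal S.O p, S.rep_mul_normPrimeIdeal_mem c⟩ : ClassSet S.O) = c' ↔
      (Quotient.mk (rightClassSetoid S.O) ⟨c'.rep * normPrimeIdeal S.O p, S.rep_mul_normPrimeIdeal_mem c'⟩ : ClassSet S.O) = c :=
  S.involutive_mk_rep_mul_normPrimeIdeal.eq_iff.trans eq_comm

/-- **`T(p)` is a symmetric matrix** (the permutation matrix of an involution). [cite: VignerasLNM800, Ch. III §5 exercice 5.8 (b)–(c)] -/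
theorem XiSetup.matrix_ramified_symm (c c' : ClassSet S.O) : matrix S.O p c c' = matrix S.O p c' c := by
  rw [S.matrix_ramified_apply c c', S.matrix_ramified_apply c' c]
  have h := S.mk_rep_mul_normPrimeIdeal_eq_iff c' c
  split_ifs with h1 h2 h2
  · rfl
  · exact absurd (h.mp h1.symm).symm h2
  · exact absurd (h.mpr h2.symm).symm h1
  · rfl

/-- `T(p)ᵀ = T(p)`. [cite: VignerasLNM800, Ch. III §5 exercice 5.8 (b)–(c)] -/
theorem XiSetup.matrix_ramified_transpose : (matrix S.O p).transpose = matrix S.O p := by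
  ext c c'
  exact S.matrix_ramified_symm c' c

/-- **`T(p)` is the permutation matrix of `W`** over any ring (Mathlib's `Equiv.Perm.permMatrix` of the permutation `W` of
`Cls O`). [cite: VignerasLNM800, Ch. III §5 exercice 5.8 (b)] -/
theorem XiSetup.map_matrix_ramified_eq_permMatrix [DecidableEq (ClassSet S.O)] {R : Type*} [AddGroupWithOne R] :
    (matrix S.O p).map (Int.cast : ℤ → R) = (S.involutive_mk_rep_mul_normPrimeIdeal.toPerm _).permMatrix R := by
  ext c c'
  rw [Matrix.map_apply, S.matrix_ramified_apply]
  simp only [PEquiv.toMatrix_apply, Equiv.toPEquiv_apply, Option.mem_def, Option.some.injEq,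
    Function.Involutive.coe_toPerm]
  have h := S.mk_rep_mul_normPrimeIdeal_eq_iff c' c
  split_ifs with h1 h2 h2
  · exact Int.cast_one
  · exact absurd (h.mp h1.symm) h2
  · exact absurd (h.mpr h2).symm h1
  · exact Int.cast_zero

/-- `T(p)` is the permutation matrix of `W` (over `ℤ`). [cite: VignerasLNM800, Ch. III §5 exercice 5.8 (b)] -/
theorem XiSetup.matrix_ramified_eq_permMatrix [DecidableEq (ClassSet S.O)] :
    matrix S.O p = (S.involutive_mk_rep_mul_normPrimeIdeal.toPerm _).permMatrix ℤ := by
  rw [← S.map_matrix_ramified_eq_permMatrix]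
  ext c c'
  rw [Matrix.map_apply, Int.cast_id]

/-- `det T(p) = sign W = ±1`. [cite: VignerasLNM800, Ch. III §5 exercice 5.8 (b)–(c)] -/
theorem XiSetup.det_matrix_ramified [Fintype (ClassSet S.O)] [DecidableEq (ClassSet S.O)] :
    (matrix S.O p).det = Equiv.Perm.sign (S.involutive_mk_rep_mul_normPrimeIdeal.toPerm _) := by
  rw [S.matrix_ramified_eq_permMatrix, Matrix.det_permutation, Int.cast_id]

/-- **`T(p)` acts on functions on `Cls O` by `(T(p) v)(c) = v([I_c P])`** (over any commutative ring). [cite: VignerasLNM800, Ch. III §5 exercice 5.8 (b)] -/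
theorem XiSetup.map_matrix_ramified_mulVec [Fintype (ClassSet S.O)] {R : Type*} [CommRing R] (v : ClassSet S.O → R)
    (c : ClassSet S.O) :
    ((matrix S.O p).map (Int.cast : ℤ → R) *ᵥ v) c =
      v (Quotient.mk (rightClassSetoid S.O) ⟨c.rep * normPrimeIdeal S.O p, S.rep_mul_normPrimeIdeal_mem c⟩) := by
  classical
  rw [S.map_matrix_ramified_eq_permMatrix, Matrix.permMatrix_mulVec, Function.comp_apply, Function.Involutive.coe_toPerm]

/-- The same over `ℤ`: `(T(p) v)(c) = v([I_c P])`. [cite: VignerasLNM800, Ch. III §5 exercice 5.8 (b)] -/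
theorem XiSetup.matrix_ramified_mulVec [Fintype (ClassSet S.O)] (v : ClassSet S.O → ℤ) (c : ClassSet S.O) :
    (matrix S.O p *ᵥ v) c =
      v (Quotient.mk (rightClassSetoid S.O) ⟨c.rep * normPrimeIdeal S.O p, S.rep_mul_normPrimeIdeal_mem c⟩) := by
  classical
  rw [S.matrix_ramified_eq_permMatrix, Matrix.permMatrix_mulVec, Function.comp_apply, Function.Involutive.coe_toPerm]

end Involution

/-! ## §2 The `±1`-eigenspaces of `T(p)` on the Brandt module `ℚ^{Cls O}` -/

section Eigenspaces

variable [Fintype (ClassSet S.O)] [DecidableEq (ClassSet S.O)]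

/-- **The `+1`-eigenspace of `T(p)`** = the functions on `Cls O` invariant under `W : [I] ↦ [I P]`. [cite: VignerasLNM800, Ch. III §5 exercice 5.8 (b)–(c)] -/
theorem XiSetup.mem_eigenspace_one_iff (v : ClassSet S.O → ℚ) :
    v ∈ Module.End.eigenspace (Matrix.toLin' ((matrix S.O p).map (Int.cast : ℤ → ℚ))) 1 ↔
      ∀ c : ClassSet S.O,
        v (Quotient.mk (rightClassSetoid S.O) ⟨c.rep * normPrimeIdeal S.O p, S.rep_mul_normPrimeIdeal_mem c⟩) = v c := by
  rw [Module.End.mem_eigenspace_iff, one_smul, Matrix.toLin'_apply, funext_iff]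
  simp only [S.map_matrix_ramified_mulVec]

/-- **The `-1`-eigenspace of `T(p)`** = the functions on `Cls O` anti-invariant under `W`. [cite: VignerasLNM800, Ch. III §5 exercice 5.8 (b)–(c)] -/
theorem XiSetup.mem_eigenspace_neg_one_iff (v : ClassSet S.O → ℚ) :
    v ∈ Module.End.eigenspace (Matrix.toLin' ((matrix S.O p).map (Int.cast : ℤ → ℚ))) (-1) ↔
      ∀ c : ClassSet S.O,
        v (Quotient.mk (rightClassSetoid S.O) ⟨c.rep * normPrimeIdeal S.O p, S.rep_mul_normPrimeIdeal_mem c⟩) = -v c := by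
  rw [Module.End.mem_eigenspace_iff, Matrix.toLin'_apply, funext_iff]
  simp only [S.map_matrix_ramified_mulVec, Pi.smul_apply, smul_eq_mul, neg_one_mul]

/-- The `W`-invariant functions are exactly the functions of the TYPE: `v ∈ E₊ ⟺ v = g ∘ typeOf` for some `g : Typ O → ℚ`
(the fibres of `typeOf` are the `W`-orbits). [cite: Voight2021, Cor. 18.5.12 and Prop. 18.5.10] -/
theorem XiSetup.mem_eigenspace_one_iff_exists_comp_typeOf (v : ClassSet S.O → ℚ) :
    v ∈ Module.End.eigenspace (Matrix.toLin' ((matrix S.O p).map (Int.cast : ℤ → ℚ))) 1 ↔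
      ∃ g : TypeSet S.O → ℚ, v = g ∘ typeOf S.O := by
  rw [S.mem_eigenspace_one_iff]
  constructor
  · intro hv
    have hfib : ∀ c c' : ClassSet S.O, typeOf S.O c = typeOf S.O c' → v c = v c' := by
      intro c c' h
      rcases S.eq_or_eq_of_typeOf_eq h.symm with rfl | rfl
      · rfl
      · exact (hv c).symm
    refine ⟨fun τ => Quotient.liftOn τ v fun c c' h => hfib c c' (Quotient.sound h), funext fun c => ?_⟩
    rfl
  · rintro ⟨g, rfl⟩ c
    exact congrArg g (S.typeOf_mk_rep_mul_normPrimeIdeal c)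

/-- **`dim E₊ = # Typ O`: the multiplicity of the eigenvalue `+1` of `T(p)` on the Brandt module is the type number** —
`E₊ ≃ ℚ^{Typ O}` by `v ↦ (τ ↦ v(c))`, `typeOf c = τ`. [cite: Voight2021, Cor. 18.5.12 and (30.9.3)] [cite: VignerasLNM800, Ch. III §5 exercice 5.8] -/
theorem XiSetup.finrank_eigenspace_one :
    Module.finrank ℚ (Module.End.eigenspace (Matrix.toLin' ((matrix S.O p).map (Int.cast : ℤ → ℚ))) 1) =
      Nat.card (TypeSet S.O) := by
  haveI : Finite (TypeSet S.O) := S.finite_typeSet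
  letI : Fintype (TypeSet S.O) := Fintype.ofFinite _
  set E := Module.End.eigenspace (Matrix.toLin' ((matrix S.O p).map (Int.cast : ℤ → ℚ))) 1 with hE
  have hmem : ∀ v : ClassSet S.O → ℚ, v ∈ E ↔ ∀ c : ClassSet S.O,
      v (Quotient.mk (rightClassSetoid S.O) ⟨c.rep * normPrimeIdeal S.O p, S.rep_mul_normPrimeIdeal_mem c⟩) = v c :=
    fun v => S.mem_eigenspace_one_iff v
  have hfib : ∀ v : ClassSet S.O → ℚ, v ∈ E → ∀ c c' : ClassSet S.O, typeOf S.O c = typeOf S.O c' → v c = v c' := by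
    intro v hv c c' h
    rcases S.eq_or_eq_of_typeOf_eq h.symm with rfl | rfl
    · rfl
    · exact ((hmem v).mp hv c).symm
  let Φ : E ≃ₗ[ℚ] (TypeSet S.O → ℚ) :=
    { toFun := fun v τ => Quotient.liftOn τ (fun c => (v : ClassSet S.O → ℚ) c) fun c c' h => hfib v.1 v.2 c c' (Quotient.sound h)
      map_add' := fun v w => funext fun τ => Quotient.inductionOn τ fun c => rfl
      map_smul' := fun a v => funext fun τ => Quotient.inductionOn τ fun c => rfl
      invFun := fun g => ⟨fun c => g (typeOf S.O c), (hmem _).mpr fun c => congrArg g (S.typeOf_mk_rep_mul_normPrimeIdeal c)⟩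
      left_inv := fun v => Subtype.ext (funext fun c => rfl)
      right_inv := fun g => funext fun τ => Quotient.inductionOn τ fun c => rfl }
  rw [Φ.finrank_eq, Module.finrank_fintype_fun_eq_card, Nat.card_eq_fintype_card]

/-- `E₊ ⊓ E₋ = 0`. [cite: VignerasLNM800, Ch. III §5 exercice 5.8 (c)] -/
theorem XiSetup.eigenspace_one_inf_eigenspace_neg_one :
    Module.End.eigenspace (Matrix.toLin' ((matrix S.O p).map (Int.cast : ℤ → ℚ))) 1 ⊓
      Module.End.eigenspace (Matrix.toLin' ((matrix S.O p).map (Int.cast : ℤ → ℚ))) (-1) = ⊥ := by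
  rw [eq_bot_iff]
  intro v hv
  rw [Submodule.mem_inf, S.mem_eigenspace_one_iff, S.mem_eigenspace_neg_one_iff] at hv
  rw [Submodule.mem_bot]
  funext c
  have h1 := hv.1 c
  have h2 := hv.2 c
  rw [Pi.zero_apply]
  linarith

/-- `E₊ + E₋ = ℚ^{Cls O}`: `v = ½(v + Wv) + ½(v - Wv)` (`T(p)² = 1`, characteristic `0`). [cite: VignerasLNM800, Ch. III §5 exercice 5.8 (c)] -/
theorem XiSetup.eigenspace_one_sup_eigenspace_neg_one :
    Module.End.eigenspace (Matrix.toLin' ((matrix S.O p).map (Int.cast : ℤ → ℚ))) 1 ⊔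
      Module.End.eigenspace (Matrix.toLin' ((matrix S.O p).map (Int.cast : ℤ → ℚ))) (-1) = ⊤ := by
  rw [eq_top_iff]
  intro v _
  rw [Submodule.mem_sup]
  set W : ClassSet S.O → ClassSet S.O := fun c =>
    Quotient.mk (rightClassSetoid S.O) ⟨c.rep * normPrimeIdeal S.O p, S.rep_mul_normPrimeIdeal_mem c⟩ with hW
  have hWW : ∀ c, W (W c) = c := fun c => S.mk_rep_mul_normPrimeIdeal_mul_normPrimeIdeal c
  refine ⟨fun c => (v c + v (W c)) / 2, (S.mem_eigenspace_one_iff _).mpr fun c => ?_,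
    fun c => (v c - v (W c)) / 2, (S.mem_eigenspace_neg_one_iff _).mpr fun c => ?_, ?_⟩
  · show (v (W c) + v (W (W c))) / 2 = (v c + v (W c)) / 2
    rw [hWW]; ring
  · show (v (W c) - v (W (W c))) / 2 = -((v c - v (W c)) / 2)
    rw [hWW]; ring
  · funext c
    show (v c + v (W c)) / 2 + (v c - v (W c)) / 2 = v c
    ring

/-- `E₊` and `E₋` are complementary: `T(p)` is diagonalisable with eigenvalues `±1`. [cite: VignerasLNM800, Ch. III §5 exercice 5.8 (c)] -/
theorem XiSetup.isCompl_eigenspace_one_eigenspace_neg_one :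
    IsCompl (Module.End.eigenspace (Matrix.toLin' ((matrix S.O p).map (Int.cast : ℤ → ℚ))) 1)
      (Module.End.eigenspace (Matrix.toLin' ((matrix S.O p).map (Int.cast : ℤ → ℚ))) (-1)) :=
  ⟨disjoint_iff.mpr S.eigenspace_one_inf_eigenspace_neg_one, codisjoint_iff.mpr S.eigenspace_one_sup_eigenspace_neg_one⟩

/-- **`dim E₋ = # Cls O - # Typ O`: the multiplicity of the eigenvalue `-1` of `T(p)` is `h - t`.** [cite: Voight2021, Cor. 18.5.12 and (30.9.3)] [cite: VignerasLNM800, Ch. III §5 exercice 5.8] -/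
theorem XiSetup.finrank_eigenspace_neg_one :
    Module.finrank ℚ (Module.End.eigenspace (Matrix.toLin' ((matrix S.O p).map (Int.cast : ℤ → ℚ))) (-1)) =
      Nat.card (ClassSet S.O) - Nat.card (TypeSet S.O) := by
  have key := Submodule.finrank_sup_add_finrank_inf_eq
    (Module.End.eigenspace (Matrix.toLin' ((matrix S.O p).map (Int.cast : ℤ → ℚ))) 1)
    (Module.End.eigenspace (Matrix.toLin' ((matrix S.O p).map (Int.cast : ℤ → ℚ))) (-1))
  rw [S.eigenspace_one_sup_eigenspace_neg_one, S.eigenspace_one_inf_eigenspace_neg_one, finrank_top, finrank_bot,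
    add_zero, S.finrank_eigenspace_one, Module.finrank_fintype_fun_eq_card, ← Nat.card_eq_fintype_card] at key
  omega

/-- `dim E₊ + dim E₋ = # Cls O`. [cite: VignerasLNM800, Ch. III §5 exercice 5.8 (c)] -/
theorem XiSetup.finrank_eigenspace_one_add_finrank_eigenspace_neg_one :
    Module.finrank ℚ (Module.End.eigenspace (Matrix.toLin' ((matrix S.O p).map (Int.cast : ℤ → ℚ))) 1) +
      Module.finrank ℚ (Module.End.eigenspace (Matrix.toLin' ((matrix S.O p).map (Int.cast : ℤ → ℚ))) (-1)) =
        Nat.card (ClassSet S.O) := by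
  rw [S.finrank_eigenspace_one, S.finrank_eigenspace_neg_one]
  have := S.natCard_typeSet_le
  omega

/-- **`T(p)` has no eigenvalue other than `±1`** (`T(p)² = 1`). [cite: VignerasLNM800, Ch. III §5 exercice 5.8 (c)] -/
theorem XiSetup.eigenspace_eq_bot_of_ne {μ : ℚ} (h1 : μ ≠ 1) (h2 : μ ≠ -1) :
    Module.End.eigenspace (Matrix.toLin' ((matrix S.O p).map (Int.cast : ℤ → ℚ))) μ = ⊥ := by
  rw [eq_bot_iff]
  intro v hv
  rw [Module.End.mem_eigenspace_iff, Matrix.toLin'_apply, funext_iff] at hv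
  simp only [S.map_matrix_ramified_mulVec, Pi.smul_apply, smul_eq_mul] at hv
  rw [Submodule.mem_bot]
  funext c
  have e1 := hv c
  have e2 := hv (Quotient.mk (rightClassSetoid S.O) ⟨c.rep * normPrimeIdeal S.O p, S.rep_mul_normPrimeIdeal_mem c⟩)
  rw [S.mk_rep_mul_normPrimeIdeal_mul_normPrimeIdeal] at e2
  have hμ : μ * μ - 1 ≠ 0 := by
    intro h0
    rcases mul_self_eq_one_iff.mp (by linarith : μ * μ = 1) with h | h
    · exact h1 h
    · exact h2 h
  have hv0 : (μ * μ - 1) * v c = 0 := by linear_combination (-μ) * e1 - e2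
  rw [Pi.zero_apply]
  exact (mul_eq_zero.mp hv0).resolve_left hμ

/-- The spectrum of `T(p)` is contained in `{1, -1}`. [cite: VignerasLNM800, Ch. III §5 exercice 5.8 (c)] -/
theorem XiSetup.hasEigenvalue_imp {μ : ℚ}
    (h : Module.End.HasEigenvalue (Matrix.toLin' ((matrix S.O p).map (Int.cast : ℤ → ℚ))) μ) : μ = 1 ∨ μ = -1 := by
  by_contra hne
  push Not at hne
  exact (Module.End.hasEigenvalue_iff.mp h) (S.eigenspace_eq_bot_of_ne hne.1 hne.2)

/-- `+1` is always an eigenvalue of `T(p)` (`t ≥ 1`: the constant functions). [cite: VignerasLNM800, Ch. III §5 exercice 5.8 (c)] -/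
theorem XiSetup.hasEigenvalue_one :
    Module.End.HasEigenvalue (Matrix.toLin' ((matrix S.O p).map (Int.cast : ℤ → ℚ))) 1 := by
  rw [Module.End.hasEigenvalue_iff, Ne, ← Submodule.finrank_eq_zero, S.finrank_eigenspace_one]
  exact (S.natCard_typeSet_pos).ne'

/-- **`-1` is an eigenvalue of `T(p)` iff `# Typ O < # Cls O`.** [cite: Voight2021, Cor. 18.5.12 and Prop. 30.9.2] -/
theorem XiSetup.hasEigenvalue_neg_one_iff :
    Module.End.HasEigenvalue (Matrix.toLin' ((matrix S.O p).map (Int.cast : ℤ → ℚ))) (-1) ↔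
      Nat.card (TypeSet S.O) < Nat.card (ClassSet S.O) := by
  rw [Module.End.hasEigenvalue_iff, Ne, ← Submodule.finrank_eq_zero, S.finrank_eigenspace_neg_one]
  have := S.natCard_typeSet_le
  omega

omit [DecidableEq (ClassSet S.O)] in
/-- **The trace of `T(p)` is `2 # Typ O - # Cls O = dim E₊ - dim E₋`.** [cite: Voight2021, (30.9.3)] [cite: VignerasLNM800, Ch. III §5 exercice 5.8] -/
theorem XiSetup.trace_matrix_ramified_eq :
    (matrix S.O p).trace = 2 * (Nat.card (TypeSet S.O) : ℤ) - Nat.card (ClassSet S.O) := by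
  have h := S.two_mul_natCard_typeSet_eq_card_add_trace
  unfold Matrix.trace
  simp only [Matrix.diag_apply]
  linarith

/-- `tr T(p) = dim E₊ - dim E₋`. [cite: VignerasLNM800, Ch. III §5 exercice 5.8 (c)] -/
theorem XiSetup.trace_matrix_ramified_eq_finrank_sub :
    (matrix S.O p).trace =
      (Module.finrank ℚ (Module.End.eigenspace (Matrix.toLin' ((matrix S.O p).map (Int.cast : ℤ → ℚ))) 1) : ℤ) -
        Module.finrank ℚ (Module.End.eigenspace (Matrix.toLin' ((matrix S.O p).map (Int.cast : ℤ → ℚ))) (-1)) := by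
  rw [S.trace_matrix_ramified_eq, S.finrank_eigenspace_one, S.finrank_eigenspace_neg_one,
    Nat.cast_sub S.natCard_typeSet_le]
  ring

/-- **Deuring's formula as eigenvalue multiplicities** (`p ≥ 5`): `dim E₊ = ½ h + ¼([h(-p)] + h(-4p))` and
`dim E₋ = ½ h - ¼([h(-p)] + h(-4p))`. [cite: Voight2021, Prop. 30.9.2] -/
theorem XiSetup.finrank_eigenspaces_eq_deuring (hp5 : 5 ≤ p) :
    (Module.finrank ℚ (Module.End.eigenspace (Matrix.toLin' ((matrix S.O p).map (Int.cast : ℤ → ℚ))) 1) : ℚ) =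
        (Nat.card (ClassSet S.O) : ℚ) / 2 +
          (((if p % 4 = 3 then BinQF.classNumber (-(p : ℤ)) else 0 : ℕ) : ℚ) + BinQF.classNumber (-(4 * (p : ℤ)))) / 4 ∧
      (Module.finrank ℚ (Module.End.eigenspace (Matrix.toLin' ((matrix S.O p).map (Int.cast : ℤ → ℚ))) (-1)) : ℚ) =
        (Nat.card (ClassSet S.O) : ℚ) / 2 -
          (((if p % 4 = 3 then BinQF.classNumber (-(p : ℤ)) else 0 : ℕ) : ℚ) + BinQF.classNumber (-(4 * (p : ℤ)))) / 4 := by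
  have h := S.natCard_typeSet_eq_deuring hp5
  rw [S.finrank_eigenspace_one, S.finrank_eigenspace_neg_one, Nat.cast_sub S.natCard_typeSet_le]
  constructor <;> linarith

end Eigenspaces

/-! ## §3 Examples -/

section Examples

/-- `p = 11`: `T(11)` on the two classes of `B_{11,∞}` is the identity — no eigenvalue `-1` (`t = h = 2`). [cite: Voight2021, Prop. 30.9.2 and Exercise 30.6] -/
theorem XiSetup.not_hasEigenvalue_neg_one_eleven (S : XiSetup 1 11) [Fintype (ClassSet S.O)] [DecidableEq (ClassSet S.O)] :
    ¬Module.End.HasEigenvalue (Matrix.toLin' ((matrix S.O 11).map (Int.cast : ℤ → ℚ))) (-1) := by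
  haveI : Fact (Nat.Prime 11) := ⟨by norm_num⟩
  rw [S.hasEigenvalue_neg_one_iff, S.natCard_typeSet_eleven, Brandt.XiSetup.natCard_classSet_eleven S]
  omega

/-- `p = 37`: `-1` IS an eigenvalue of `T(37)` (`h = 3 > t = 2`): the first prime where `W` moves a class. [cite: Voight2021, Prop. 30.9.2 and Exercise 30.6] -/
theorem XiSetup.hasEigenvalue_neg_one_thirtySeven (S : XiSetup 1 37) [Fintype (ClassSet S.O)] [DecidableEq (ClassSet S.O)] :
    Module.End.HasEigenvalue (Matrix.toLin' ((matrix S.O 37).map (Int.cast : ℤ → ℚ))) (-1) := by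
  haveI : Fact (Nat.Prime 37) := ⟨by norm_num⟩
  rw [S.hasEigenvalue_neg_one_iff]
  have h := S.natCard_typeSet_thirtySeven
  omega

/-- `p = 37`: `dim E₊ = 2`, `dim E₋ = 1`. [cite: Voight2021, Prop. 30.9.2 and Exercise 30.6] -/
theorem XiSetup.finrank_eigenspaces_thirtySeven (S : XiSetup 1 37) [Fintype (ClassSet S.O)] [DecidableEq (ClassSet S.O)] :
    Module.finrank ℚ (Module.End.eigenspace (Matrix.toLin' ((matrix S.O 37).map (Int.cast : ℤ → ℚ))) 1) = 2 ∧
      Module.finrank ℚ (Module.End.eigenspace (Matrix.toLin' ((matrix S.O 37).map (Int.cast : ℤ → ℚ))) (-1)) = 1 := by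
  haveI : Fact (Nat.Prime 37) := ⟨by norm_num⟩
  rw [S.finrank_eigenspace_one, S.finrank_eigenspace_neg_one]
  have h := S.natCard_typeSet_thirtySeven
  omega

end Examples

end Brandt

end Literature.NumberTheory.Automorphic
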